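import Summits.QuantumFields.BalabanUV.Beta.AxialDressingRootedBmReflection

/-!
# PREPARATORY (pending β-lead RULING (R42-1); touches NO wall object): the BLOCK-MEAN projector kernel `piKBm`, the dressings
# `dressKBmAt := piKBm∘K∘piKBmᵀ`, `coDressKBmAt := piKBmᵀ∘K∘piKBm` in COMP FORM, and the reflection invariance `refK_piKBm`

HONEST FRAMING (cell charter, verbatim): «discharging BetaPertH makes Balaban's UV stability UNCONDITIONAL — a real
constructive-QFT result; it is NOT the continuum limit and NOT the Clay problem.»  DERIVED cell leaf (β sub-cell, lane an2 gen 12,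
NOTE X-an2-42 repair (A), file 1); no statement of Bałaban's papers, no `[cite:]` tag, no `Prop` fact; instantiates no wall binder.
NOT `BetaPertH`; NOT continuum; NOT Clay.

## What is here (twins of `AxialDressingRootedKernel` §1/§3 and `AxialDressingRootedReflection` §3 with `pm ↦ pmBm`)
* §1 `piKBm ρ N` (field block `[x′ − x ∈ cube]·pmBm ρ N β x′ α x`, multiplier block identity), the fibre-contraction rules, `abs_pmBm_le`,
  `decays_piKBm` (every rate; constant `cPb d N δ`), `spr_piKBm`, `pmBm_shift`, `shiftK_piKBm`.
* §2 `dressKBmAt ρ N K := comp (comp piKBm K) (trK piKBm)` and `coDressKBmAt ρ N K := comp (comp (trK piKBm) K) piKBm` (DEFINITIONS in comp form —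
  no window-sum operator), `comp_piKBm_inr`, `colH_coDressKBmAt`, `decays_coDressKBmAt`, `spr_coDressKBmAt`, `shiftK_coDressKBmAt`.
* §3 `refK_piKBm` (`Odd N`, centred root: `pmBm_refl` + the Bm window lemmas), `refK_coDressKBmAt`, `refK_coDressKBmAt_KInvStep`.
All declarations `[folklore]`; axioms standard.  Provenance: b2b-balaban β sub-cell, unit beta-an2 gen 12, 2026-08-19.
-/

open Finset
open scoped BigOperators
open Literature.MathematicalPhysics.QuantumFieldTheory
open Literature.MathematicalPhysics.QuantumFieldTheory.Balaban1983to89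
open Literature.MathematicalPhysics.QuantumFieldTheory.Balaban1983to89.Beta
open B12Sec2to5 (l1 l1_nonneg)
open ExpKernelCalculus (MKer Decays BiLoc comp tr shiftK l1_sub_symm)
open AffineAveraging (Form0 Form1 box toSite unitVec unitVec_apply blockSum)
open AveragingContours (blk grad shift)
open AveragingContoursRooted (treeGaugeAt ctrOff ctr ctrOff_mem_box)
open RootedComb (axProjAt axProjAt_apply ctr_eq_toSite)
open AxialProjector (blk_add_zsmul)
open PolarizationSign (reflSign)
open KernelReflection (LegMap refK refK_apply comp_refK)
open ResolventReflection (sref bref bref_apply bref_bref mref mref_mref Φ Φ_r_inl Φ_r_inr Φ_s_inl Φ_s_inr reflSign_mul_self refK_KInvStep)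
open OneStepResolventKernel (Fib)
open OneStepKernelFamily (KInvStep decays_KInvStep shiftK_KInvStep colH)
open Summit.QuantumFields.BalabanUV.Beta.TameKernelCalculus
open Summit.QuantumFields.BalabanUV.Beta.AxialProjectorBlockMean (blockMeanAt bmGaugeAt axProjBmAt axProjBmAt_eq)

namespace Summit.QuantumFields.BalabanUV.Beta.AxialDressingRooted

noncomputable section

variable {d : ℕ}

/-! ## §1 The block-mean projector kernel `piKBm` -/

section PiKBm

/-- [folklore] **THE BLOCK-MEAN PROJECTOR KERNEL** `piKBm ρ N`: field block `[x′ − x ∈ cube]·pmBm ρ N β x′ α x`, multiplier block the identity. -/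
def piKBm (ρ : Fin (d + 1) → ℤ) (N : ℕ) : MKer (d + 1) (Fib d) :=
  fun x x' a b =>
    match a, b with
    | Sum.inl α, Sum.inl β => if x' - x ∈ cube (d + 1) N then pmBm ρ N β x' α x else 0
    | Sum.inl _, Sum.inr _ => 0
    | Sum.inr _, Sum.inl _ => 0
    | Sum.inr m, Sum.inr m' => if x = x' ∧ m = m' then 1 else 0

variable (ρ : Fin (d + 1) → ℤ) (N : ℕ)

/-- [folklore] Field–field entry. -/
theorem piKBm_inl_inl (x x' : Fin (d + 1) → ℤ) (α β : Fin (d + 1)) :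
    piKBm ρ N x x' (Sum.inl α) (Sum.inl β) = if x' - x ∈ cube (d + 1) N then pmBm ρ N β x' α x else 0 := rfl

/-- [folklore] Field–multiplier entry vanishes. -/
theorem piKBm_inl_inr (x x' : Fin (d + 1) → ℤ) (α m : Fin (d + 1)) : piKBm ρ N x x' (Sum.inl α) (Sum.inr m) = 0 := rfl

/-- [folklore] Multiplier–field entry vanishes. -/
theorem piKBm_inr_inl (x x' : Fin (d + 1) → ℤ) (m α : Fin (d + 1)) : piKBm ρ N x x' (Sum.inr m) (Sum.inl α) = 0 := rfl

/-- [folklore] Multiplier–multiplier entry is the identity. -/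
theorem piKBm_inr_inr (x x' : Fin (d + 1) → ℤ) (m m' : Fin (d + 1)) :
    piKBm ρ N x x' (Sum.inr m) (Sum.inr m') = if x = x' ∧ m = m' then 1 else 0 := rfl

/-- [folklore] Column contraction, field column: a windowed `pmBm`-sum. -/
theorem sum_piKBm_col_inl (u u' : Fin (d + 1) → ℤ) (κ' : Fin (d + 1)) (g : Fib d → ℝ) :
    ∑ f : Fib d, piKBm ρ N u u' f (Sum.inl κ') * g f =
      if u' - u ∈ cube (d + 1) N then ∑ κ : Fin (d + 1), pmBm ρ N κ' u' κ u * g (Sum.inl κ) else 0 := by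
  rw [Fintype.sum_sum_type]
  simp only [piKBm_inl_inl, piKBm_inr_inl, zero_mul, Finset.sum_const_zero, add_zero]
  split_ifs
  · rfl
  · simp

/-- [folklore] `|pmBm| ≤ 1 + 4(d+1)N` for an in-block root (`|pm| ≤ 1 + 2(d+1)N`, each block mean of the tree integral `≤ (d+1)N`). -/
theorem abs_pmBm_le {N : ℕ} (hN : 1 ≤ N) {r : Fin (d + 1) → ℕ} (hr : r ∈ box (d + 1) N) (β : Fin (d + 1)) (p : Fin (d + 1) → ℤ)
    (α : Fin (d + 1)) (q : Fin (d + 1) → ℤ) : |pmBm (toSite r) N β p α q| ≤ 1 + 4 * (((d : ℝ) + 1) * N) := by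
  have hbm : ∀ x, |blockMeanAt N (treeGaugeAt (toSite r) (fun κ z => (bondInd α q κ z : ℝ)) N) x| ≤ ((d : ℝ) + 1) * N := by
    intro x
    unfold blockMeanAt
    have hNn : (0 : ℝ) < (N : ℝ) ^ (d + 1) := pow_pos (by exact_mod_cast hN) _
    rw [abs_div, abs_of_pos hNn, div_le_iff₀ hNn]
    have hcard : (box (d + 1) N).card = N ^ (d + 1) := by
      simp only [AffineAveraging.box, Fintype.card_piFinset, Finset.card_range, Finset.prod_const, Finset.card_univ,
        Fintype.card_fin]
    unfold blockSum
    refine (Finset.abs_sum_le_sum_abs _ _).trans ?_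
    have hterm : ∀ b ∈ box (d + 1) N,
        |treeGaugeAt (toSite r) (fun κ z => (bondInd α q κ z : ℝ)) N ((N : ℤ) • blk N x + toSite b)| ≤ ((d : ℝ) + 1) * N := by
      intro b _
      have hcast : treeGaugeAt (toSite r) (fun κ z => (bondInd α q κ z : ℝ)) N ((N : ℤ) • blk N x + toSite b) =
          ((treeGaugeAt (toSite r) (bondInd α q) N ((N : ℤ) • blk N x + toSite b) : ℤ) : ℝ) :=
        treeGaugeAt_map (Int.castAddHom ℝ) (toSite r) (bondInd α q) N _
      rw [hcast]
      have h := abs_treeGaugeAt_bondInd_le hN hr α q ((N : ℤ) • blk N x + toSite b)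
      have h' : ((|treeGaugeAt (toSite r) (bondInd α q) N ((N : ℤ) • blk N x + toSite b)| : ℤ) : ℝ) ≤ (((d + 1 : ℕ) : ℤ) * N : ℤ) := by
        exact_mod_cast h
      rw [Int.cast_abs] at h'
      push_cast at h'
      exact h'
    refine (Finset.sum_le_sum hterm).trans ?_
    rw [Finset.sum_const, hcard, nsmul_eq_mul]
    push_cast
    nlinarith [pow_pos (show (0:ℝ) < N by exact_mod_cast hN) (d + 1)]
  rw [pmBm_eq]
  have h1 := abs_pm_le_real hN hr β p α q
  have h2 := hbm (p + unitVec β)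
  have h3 := hbm p
  have e : (((d + 1 : ℕ) : ℝ)) = (d : ℝ) + 1 := by push_cast; ring
  calc |(pm (toSite r) N β p α q : ℝ) + (blockMeanAt N _ (p + unitVec β) - blockMeanAt N _ p)|
      ≤ |(pm (toSite r) N β p α q : ℝ)| + |blockMeanAt N _ (p + unitVec β) - blockMeanAt N _ p| := abs_add_le _ _
    _ ≤ |(pm (toSite r) N β p α q : ℝ)| + (|blockMeanAt N _ (p + unitVec β)| + |blockMeanAt N _ p|) :=
        add_le_add le_rfl (abs_sub _ _)
    _ ≤ (1 + 2 * (((d + 1 : ℕ) : ℝ) * N)) + ((((d : ℝ) + 1) * N) + (((d : ℝ) + 1) * N)) := add_le_add h1 (add_le_add h2 h3)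
    _ = 1 + 4 * (((d : ℝ) + 1) * N) := by rw [e]; ring

/-- [folklore] The decay constant of `piKBm` at rate `δ`. -/
def cPb (d N : ℕ) (δ : ℝ) : ℝ := (1 + 4 * (((d : ℝ) + 1) * N)) * Real.exp (δ * (((d : ℝ) + 1) * N))

/-- [folklore] `0 ≤ cPb`. -/
theorem cPb_nonneg (d N : ℕ) (δ : ℝ) : 0 ≤ cPb d N δ := by
  unfold cPb
  have : (0 : ℝ) ≤ ((d : ℝ) + 1) * N := by positivity
  exact mul_nonneg (by linarith) (Real.exp_pos _).le

/-- [folklore] `1 ≤ cPb` for `δ ≥ 0`. -/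
theorem one_le_cPb (d N : ℕ) {δ : ℝ} (hδ : 0 ≤ δ) : 1 ≤ cPb d N δ := by
  unfold cPb
  have h1 : (1 : ℝ) ≤ 1 + 4 * (((d : ℝ) + 1) * N) := by
    have : (0 : ℝ) ≤ ((d : ℝ) + 1) * N := by positivity
    linarith
  have h2 : (1 : ℝ) ≤ Real.exp (δ * (((d : ℝ) + 1) * N)) := Real.one_le_exp (by positivity)
  nlinarith

/-- [folklore] **`piKBm` DECAYS AT EVERY RATE** (in-block root). -/
theorem decays_piKBm {N : ℕ} (hN : 1 ≤ N) {r : Fin (d + 1) → ℕ} (hr : r ∈ box (d + 1) N) {δ : ℝ} (hδ : 0 ≤ δ) :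
    Decays (piKBm (toSite r) N) (cPb d N δ) δ := by
  intro x x' a b
  have hpos : 0 ≤ cPb d N δ * Real.exp (-δ * l1 (x - x')) := mul_nonneg (cPb_nonneg d N δ) (Real.exp_pos _).le
  rcases a with α | m <;> rcases b with β | m'
  · rw [piKBm_inl_inl]
    split_ifs with h
    · have hl : l1 (x - x') ≤ ((d : ℝ) + 1) * N := by
        rw [l1_sub_symm]
        have := l1_le_of_mem_cube h
        push_cast at this
        exact this
      have hpm := abs_pmBm_le hN hr β x' α x
      have hA : (0 : ℝ) ≤ 1 + 4 * (((d : ℝ) + 1) * N) := by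
        have : (0 : ℝ) ≤ ((d : ℝ) + 1) * N := by positivity
        linarith
      have he : (1 : ℝ) ≤ Real.exp (δ * (((d : ℝ) + 1) * N)) * Real.exp (-δ * l1 (x - x')) := by
        rw [← Real.exp_add]
        exact Real.one_le_exp (by nlinarith)
      calc |pmBm (toSite r) N β x' α x| ≤ (1 + 4 * (((d : ℝ) + 1) * N)) * 1 := by rw [mul_one]; exact hpm
        _ ≤ (1 + 4 * (((d : ℝ) + 1) * N)) * (Real.exp (δ * (((d : ℝ) + 1) * N)) * Real.exp (-δ * l1 (x - x'))) :=
            mul_le_mul_of_nonneg_left he hA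
        _ = cPb d N δ * Real.exp (-δ * l1 (x - x')) := by unfold cPb; ring
    · rw [abs_zero]; exact hpos
  · rw [piKBm_inl_inr, abs_zero]; exact hpos
  · rw [piKBm_inr_inl, abs_zero]; exact hpos
  · rw [piKBm_inr_inr]
    split_ifs with h
    · rw [h.1, sub_self, abs_one]
      have h0 : l1 (0 : Fin (d + 1) → ℤ) = 0 := by simp [l1]
      rw [h0, mul_zero, Real.exp_zero, mul_one]
      exact one_le_cPb d N hδ
    · rw [abs_zero]; exact hpos

/-- [folklore] `piKBm` is spread. -/
theorem spr_piKBm {N : ℕ} (hN : 1 ≤ N) {r : Fin (d + 1) → ℕ} (hr : r ∈ box (d + 1) N) : Spr (piKBm (toSite r) N) :=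
  ⟨cPb d N 1, 1, one_pos, decays_piKBm hN hr zero_le_one⟩

/-- [folklore] So is its transpose. -/
theorem spr_trK_piKBm {N : ℕ} (hN : 1 ≤ N) {r : Fin (d + 1) → ℕ} (hr : r ∈ box (d + 1) N) :
    Spr (trK (piKBm (toSite r) N)) :=
  (spr_piKBm hN hr).trK

/-- [folklore] The block-mean tree gauge is coarse-translation covariant, read as the matrix entry: `pmBm (p + N•z) (q + N•z) = pmBm p q`. -/
theorem pmBm_shift (ρ : Fin (d + 1) → ℤ) {N : ℕ} (hN : 1 ≤ N) (β : Fin (d + 1)) (p : Fin (d + 1) → ℤ) (α : Fin (d + 1))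
    (q z : Fin (d + 1) → ℤ) : pmBm ρ N β (p + (N : ℤ) • z) α (q + (N : ℤ) • z) = pmBm ρ N β p α q := by
  -- the real indicator of the shifted bond is the shift of the indicator
  have hind : (fun κ u => (bondInd α (q + (N : ℤ) • z) κ u : ℝ)) =
      shift (-((N : ℤ) • z)) (fun κ u => (bondInd α q κ u : ℝ)) := by
    funext κ u
    simp only [shift, bondInd_apply]
    by_cases h : κ = α ∧ u = q + (N : ℤ) • z
    · rw [if_pos h, if_pos ⟨h.1, by rw [h.2]; abel⟩]
    · rw [if_neg h, if_neg (fun h' => h ⟨h'.1, by rw [← sub_eq_iff_eq_add.mpr h'.2.symm]; abel⟩)]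
  -- tree gauge and block mean commute with coarse shifts
  have htg : ∀ x, treeGaugeAt ρ (shift (-((N : ℤ) • z)) (fun κ u => (bondInd α q κ u : ℝ))) N x =
      treeGaugeAt ρ (fun κ u => (bondInd α q κ u : ℝ)) N (x + (N : ℤ) • (-z)) := by
    intro x
    rw [treeGaugeAt_shift ρ hN, smul_neg]
  have hbm : ∀ x, blockMeanAt N (treeGaugeAt ρ (shift (-((N : ℤ) • z)) (fun κ u => (bondInd α q κ u : ℝ))) N) x =
      blockMeanAt N (treeGaugeAt ρ (fun κ u => (bondInd α q κ u : ℝ)) N) (x + (N : ℤ) • (-z)) := by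
    intro x
    unfold blockMeanAt blockSum
    rw [blk_add_zsmul hN]
    congr 1
    refine Finset.sum_congr rfl fun b _ => ?_
    rw [htg, smul_add, add_right_comm]
  rw [pmBm_eq, pmBm_eq, pm_shift ρ hN, hind, hbm, hbm]
  have e1 : p + (N : ℤ) • z + unitVec β + (N : ℤ) • -z = p + unitVec β := by rw [smul_neg]; abel
  have e2 : p + (N : ℤ) • z + (N : ℤ) • -z = p := by rw [smul_neg]; abel
  rw [e1, e2]

/-- [folklore] `piKBm` is block-translation invariant. -/
theorem shiftK_piKBm (ρ : Fin (d + 1) → ℤ) {N : ℕ} (hN : 1 ≤ N) (t : Fin (d + 1) → ℤ) :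
    shiftK (-((N : ℤ) • t)) (piKBm ρ N) = piKBm ρ N := by
  funext x x' a b
  show piKBm ρ N (x + -((N : ℤ) • t)) (x' + -((N : ℤ) • t)) a b = piKBm ρ N x x' a b
  rcases a with α | m <;> rcases b with β | m'
  · rw [piKBm_inl_inl, piKBm_inl_inl, add_sub_add_right_eq_sub,
      show -((N : ℤ) • t) = (N : ℤ) • (-t) from (smul_neg _ _).symm, pmBm_shift ρ hN]
  · rfl
  · rfl
  · rw [piKBm_inr_inr, piKBm_inr_inr]
    simp only [add_left_inj]

end PiKBm

/-! ## §2 The dressings in comp form and the co-dressed kernel -/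

section CompBm

variable (ρ : Fin (d + 1) → ℤ) (N : ℕ)

/-- [folklore] **THE BLOCK-MEAN DRESSING OF A KERNEL** (comp form): `dressKBmAt ρ N K := piKBm∘K∘piKBmᵀ`. -/
def dressKBmAt (K : MKer (d + 1) (Fib d)) : MKer (d + 1) (Fib d) := comp (comp (piKBm ρ N) K) (trK (piKBm ρ N))

/-- [folklore] **THE BLOCK-MEAN CO-DRESSED KERNEL** `coDressKBmAt ρ N K := piKBmᵀ∘K∘piKBm`. -/
def coDressKBmAt (K : MKer (d + 1) (Fib d)) : MKer (d + 1) (Fib d) := comp (comp (trK (piKBm ρ N)) K) (piKBm ρ N)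

/-- [folklore] `coDressKBmAt` unfolds. -/
theorem coDressKBmAt_eq (K : MKer (d + 1) (Fib d)) :
    coDressKBmAt ρ N K = comp (comp (trK (piKBm ρ N)) K) (piKBm ρ N) := rfl

/-- [folklore] Right composition with `piKBm` does not touch a multiplier column. -/
theorem comp_piKBm_inr (A : MKer (d + 1) (Fib d)) (x y : Fin (d + 1) → ℤ) (a : Fib d) (μ : Fin (d + 1)) :
    comp A (piKBm ρ N) x y a (Sum.inr μ) = A x y a (Sum.inr μ) := by
  unfold ExpKernelCalculus.comp
  have h : ∀ y', ∑ f : Fib d, A x y' a f * piKBm ρ N y' y f (Sum.inr μ) = if y' = y then A x y' a (Sum.inr μ) else 0 := by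
    intro y'
    rw [Fintype.sum_sum_type]
    simp only [piKBm_inl_inr, piKBm_inr_inr, mul_zero, Finset.sum_const_zero, zero_add]
    by_cases hy : y' = y
    · simp only [hy, true_and, mul_ite, mul_one, mul_zero, Finset.sum_ite_eq', Finset.mem_univ, if_true]
    · simp [hy]
  simp_rw [h]
  rw [tsum_point']

/-- [folklore] The `ℋ`-column of the co-dressed kernel is the windowed `Π_bm`-image of the `ℋ`-column of `K`. -/
theorem colH_coDressKBmAt (K : MKer (d + 1) (Fib d)) (μ : Fin (d + 1)) (y : Fin (d + 1) → ℤ) (κ' : Fin (d + 1))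
    (u' : Fin (d + 1) → ℤ) :
    colH (coDressKBmAt ρ N K) N μ y κ' u' =
      ∑ v ∈ cube (d + 1) N, ∑ κ : Fin (d + 1), pmBm ρ N κ' u' κ (u' - v) * colH K N μ y κ (u' - v) := by
  unfold colH
  rw [coDressKBmAt_eq, comp_piKBm_inr]
  unfold ExpKernelCalculus.comp
  simp only [trK]
  have h : ∀ u, ∑ f : Fib d, piKBm ρ N u u' f (Sum.inl κ') * K u ((N : ℤ) • y) f (Sum.inr μ) =
      if u' - u ∈ cube (d + 1) N then
        ∑ κ : Fin (d + 1), pmBm ρ N κ' u' κ u * K u ((N : ℤ) • y) (Sum.inl κ) (Sum.inr μ) else 0 := fun u =>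
    sum_piKBm_col_inl ρ N u u' κ' (fun f => K u ((N : ℤ) • y) f (Sum.inr μ))
  simp_rw [h]
  rw [tsum_window']

/-- [folklore] The co-dressed kernel decays (in-block root). -/
theorem decays_coDressKBmAt {N : ℕ} (hN : 1 ≤ N) {r : Fin (d + 1) → ℕ} (hr : r ∈ box (d + 1) N)
    {K : MKer (d + 1) (Fib d)} (hK : ∃ δ C : ℝ, 0 < δ ∧ 0 ≤ C ∧ Decays K C δ) :
    ∃ δ C : ℝ, 0 < δ ∧ 0 ≤ C ∧ Decays (coDressKBmAt (toSite r) N K) C δ := by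
  obtain ⟨δ, C, hδ, -, hK⟩ := hK
  have hPt : Decays (trK (piKBm (toSite r) N)) (cPb d N δ) δ := decays_trK (decays_piKBm hN hr hδ.le)
  have h1 := BalabanStepJetsSucc.decays_comp hPt hK (show 0 ≤ δ / 2 by linarith) (show δ / 2 < δ by linarith)
  have hP : Decays (piKBm (toSite r) N) (cPb d N (δ / 2)) (δ / 2) := decays_piKBm hN hr (by linarith)
  have h2 := BalabanStepJetsSucc.decays_comp h1 hP (show 0 ≤ δ / 4 by linarith) (show δ / 4 < δ / 2 by linarith)
  exact ⟨δ / 4, _, by linarith, h2.nonneg (Sum.inl 0), h2⟩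

/-- [folklore] The co-dressed kernel of a spread kernel is spread. -/
theorem spr_coDressKBmAt {N : ℕ} (hN : 1 ≤ N) {r : Fin (d + 1) → ℕ} (hr : r ∈ box (d + 1) N)
    {K : MKer (d + 1) (Fib d)} (hK : Spr K) : Spr (coDressKBmAt (toSite r) N K) :=
  spr_comp (spr_comp (spr_trK_piKBm hN hr) hK) (spr_piKBm hN hr)

/-- [folklore] Block-translation covariance of the co-dressed kernel. -/
theorem shiftK_coDressKBmAt (ρ : Fin (d + 1) → ℤ) {N : ℕ} (hN : 1 ≤ N) {K : MKer (d + 1) (Fib d)}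
    (hKs : ∀ t : Fin (d + 1) → ℤ, shiftK (-((N : ℤ) • t)) K = K) (t : Fin (d + 1) → ℤ) :
    shiftK (-((N : ℤ) • t)) (coDressKBmAt ρ N K) = coDressKBmAt ρ N K := by
  rw [coDressKBmAt_eq, ← ExpKernelCalculus.comp_shiftK, ← ExpKernelCalculus.comp_shiftK, ← trK_shiftK, shiftK_piKBm ρ hN, hKs]

end CompBm

/-! ## §3 Reflection invariance at the centred root -/

section ReflBm

/-- [folklore] **`refK (Φ N α) (piKBm ctr N) = piKBm ctr N`** (`N` odd). -/
theorem refK_piKBm {N : ℕ} (hN : Odd N) (α : Fin (d + 1)) :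
    refK (Φ N α) (piKBm (toSite (ctrOff (d + 1) N)) N) = piKBm (d := d) (toSite (ctrOff (d + 1) N)) N := by
  have hN1 : 1 ≤ N := hN.pos
  have hr : ctrOff (d + 1) N ∈ box (d + 1) N := ctrOff_mem_box hN1
  funext x x' a b
  rw [refK_apply]
  rcases a with a | m <;> rcases b with b | m'
  · simp only [Φ_s_inl, Φ_r_inl, piKBm_inl_inl]
    by_cases h0 : pmBm (toSite (ctrOff (d + 1) N)) N b x' a x = 0
    · have h0' : pmBm (toSite (ctrOff (d + 1) N)) N b (bref α b x') a (bref α a x) = 0 := by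
        have e := pmBm_refl hN α b x' a x
        rw [h0] at e
        have hsa := reflSign_mul_self α a
        have hsb := reflSign_mul_self α b
        have : reflSign α a * reflSign α b ≠ 0 := by
          intro hz
          have := congrArg (fun t => t * (reflSign α a * reflSign α b)) hz
          simp only [zero_mul] at this
          nlinarith [hsa, hsb]
        rcases mul_eq_zero.1 e.symm with h1 | h1
        · exact absurd h1 this
        · exact h1
      rw [h0']
      split_ifs <;> simp [h0]
    · rw [if_pos (window_refl_of_pmBm_ne_zero hN1 hr h0 α), if_pos (window_of_pmBm_ne_zero hN1 hr h0), pmBm_refl hN α b x' a x]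
  · simp [piKBm_inl_inr]
  · simp [piKBm_inr_inl]
  · simp only [Φ_s_inr, Φ_r_inr, piKBm_inr_inr]
    by_cases hm : m = m'
    · subst hm
      rw [reflSign_mul_self, one_mul]
      by_cases hx : x = x'
      · subst hx; simp
      · have hx' : mref N α m x ≠ mref N α m x' := fun e => hx (mref_inj.1 e)
        simp [hx, hx']
    · simp [hm]

/-- [folklore] **REFLECTION INVARIANCE OF THE BLOCK-MEAN CO-DRESSED KERNEL** (centred root, `N` odd, `K` spread and reflection-invariant). -/
theorem refK_coDressKBmAt {N : ℕ} (hN : Odd N) {K : MKer (d + 1) (Fib d)} (hK : Spr K) (α : Fin (d + 1))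
    (hKr : refK (Φ N α) K = K) :
    refK (Φ N α) (coDressKBmAt (toSite (ctrOff (d + 1) N)) N K) = coDressKBmAt (toSite (ctrOff (d + 1) N)) N K := by
  have hN1 : 1 ≤ N := hN.pos
  have hr : ctrOff (d + 1) N ∈ box (d + 1) N := ctrOff_mem_box hN1
  have sP : Spr (piKBm (d := d) (toSite (ctrOff (d + 1) N)) N) := spr_piKBm hN1 hr
  have sPt : Spr (trK (piKBm (d := d) (toSite (ctrOff (d + 1) N)) N)) := spr_trK_piKBm hN1 hr
  rw [coDressKBmAt_eq, ← comp_refK (Φ N α) (fun x z a f b => slice_tame (spr_comp sPt hK).tame sP.tame x z a f b),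
    ← comp_refK (Φ N α) (fun x z a f b => slice_tame sPt.tame hK.tame x z a f b), refK_trK, refK_piKBm hN α, hKr]

/-- [folklore] … in particular for the decimated composite resolvents `KInvStep Lc j`. -/
theorem refK_coDressKBmAt_KInvStep {Lc : ℕ} [NeZero Lc] (hLc : Odd Lc) (j : ℕ) (α : Fin (d + 1)) :
    refK (Φ Lc α) (coDressKBmAt (toSite (ctrOff (d + 1) Lc)) Lc (KInvStep (d := d) Lc j)) =
      coDressKBmAt (toSite (ctrOff (d + 1) Lc)) Lc (KInvStep (d := d) Lc j) := by
  obtain ⟨δ, C, hδ, -, hK⟩ := decays_KInvStep (d := d) (Lc := Lc) j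
  exact refK_coDressKBmAt hLc ⟨C, δ, hδ, hK⟩ α (refK_KInvStep j α)

end ReflBm

end

end Summit.QuantumFields.BalabanUV.Beta.AxialDressingRooted
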